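import Literature.Analysis.FluidPDE.AxisymRadialQuotient
import Literature.Analysis.FluidPDE.IsometryInvariance
import HarnessLib

/-!
# The smooth Hou–Li variables `u^θ/r`, `ω^θ/r`, `u^r/r` and the elliptic identity
# `Δ(u^r/r) + (2/r)∂ᵣ(u^r/r) = ∂_z(ω^θ/r)`

Analysis/FluidPDE support file (definitions with bodies + proved results; no named facts) on the
decomposition path of the named fact
`Literature.Analysis.FluidPDE.LeiZhang2017_smallSwirl_regularity` (Z. Lei, Q. S. Zhang,
Pacific J. Math. 289 (2017) = arXiv:1505.02628, Thm. 1.4). The a-priori estimate of Lei–Zhang,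
§4, is written in `Ω = ω^θ/r`, `V² = r (u^θ/r)²` and `v^r/r`, and its key elliptic input is

> **Lemma 2.1** (Hou–Lei–Li 2008; Lei 2015, (4.5)–(4.6)). `‖∇(v^r/r)‖_{L²} ≤ K₀ ‖Ω‖_{L²}`,
> `‖∇²(v^r/r)‖_{L²} ≤ K₀ ‖∂_z Ω‖_{L²}`.

This file introduces the three smooth quotients of an axisymmetric field `u` (smooth across the
axis by `AxisymRadialQuotient`):

* `angVelQuot u = radQuot (swirl u)` — `u^θ/r = Γ/r²` (Hou–Li's `u₁`);
* `angVortQuot u = radQuot (swirl (curl u))` — `ω^θ/r` (Hou–Li's `ω₁`, Lei–Zhang's `Ω`);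
* `radVelQuot u = radQuot (x ↦ x₀u₀ + x₁u₁)` — `u^r/r`,

and proves the pointwise **elliptic identity behind Lemma 2.1**: for an axisymmetric
divergence-free `u ∈ C³`,

  `Δ (radVelQuot u) + 2 radDerivQuot (radVelQuot u) = ∂₂ (angVortQuot u)` on all of `ℝ³`

(`theorem laplacian_radVelQuot_add`), i.e. `(∂ᵣ² + (3/r)∂ᵣ + ∂_z²)(u^r/r) = ∂_z(ω^θ/r)` — the
`z`-derivative of Hou–Li's `−(∂ᵣ² + (3/r)∂ᵣ + ∂_z²)ψ₁ = ω₁`, `u^r/r = −∂_zψ₁` (Hou–Li 2008, §2),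
written without the stream function. Proof: both sides are continuous axisymmetric scalars, so
it suffices to check the identity at meridian points `x = (s, 0, z)`, `s ≠ 0`; there
`u^r/r = u₀/x₀` along the lines through `x` in the directions `e₀`, `e₂`, the cylindrical
Laplacian of an axisymmetric scalar is `∂₀² + (1/x₀)∂₀ + ∂₂²`
(`IsAxisymmetricScalar.mul_fderiv_fderiv_single_one`), `ω^θ = ∂₂u₀ − ∂₀u₂`, and the difference
of the two sides is `(1/x₀) ∂₀(∂₀u₀ + u₀/x₀ + ∂₂u₂) = (1/x₀) ∂₀(div u) = 0`, using the
infinitesimal axisymmetry `x₀ ∂₁u = J u` on the meridian plane (`∂₁u₁ = u₀/x₀`) and its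
`e₀`-derivative. From this identity Lemma 2.1 follows with `K₀ = 1` by two integrations by parts
(sibling file).

## Mathlib / tree search

Tree: `radQuot`, `radDerivQuot` and their API (`AxisymRadialQuotient`);
`IsAxisymmetric.fderiv_rotGen`, `rotGen_eq_sub_single` (`SwirlTransportProofs`);
`IsAxisymmetricScalar.mul_fderiv_fderiv_single_one`, `eq_of_eq_off_ker`
(`AxisymmetricLiftR5`); `laplacian_eq_sum_fderiv_fderiv`, `divergence_eq_sum_inner_fderiv`
(`WholeSpaceIBP`, `VectorCalculus`); `laplacian_comp_linearIsometryEquiv_symm`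
(`IsometryInvariance`). `lean search 'radVelQuot|angVortQuot|HouLeiLi'`: nothing before this
file.

## References

* Z. Lei, Q. S. Zhang, Pacific J. Math. 289 (2017) = arXiv:1505.02628, Lemma 2.1 and §4.
  [LeiZhang2017]
* T. Y. Hou, Z. Lei, C. Li, Comm. PDE 33 (2008) 1622–1637 (the estimate, periodic case);
  Z. Lei, J. Differential Equations 259 (2015) = arXiv:1212.5968, (4.5)–(4.6).
* T. Y. Hou, C. Li, Comm. Pure Appl. Math. 61 (2008) 661–697, §2 (the variables `u₁, ω₁, ψ₁`).
-/

noncomputable section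

open MeasureTheory Set Function Filter Topology
open scoped ContDiff Laplacian

namespace Literature.Analysis.FluidPDE

/-! ### The three smooth quotients -/

section Defs

variable {u : EuclideanSpace ℝ (Fin 3) → EuclideanSpace ℝ (Fin 3)}

/-- `u^θ/r = Γ/r²`, the smooth radial quotient of the swirl `Γ = swirl u` (Hou–Li's `u₁`;
Lei–Zhang's `V² = r (u^θ/r)²`). [folklore] -/
def angVelQuot (u : EuclideanSpace ℝ (Fin 3) → EuclideanSpace ℝ (Fin 3)) :
    EuclideanSpace ℝ (Fin 3) → ℝ :=
  radQuot (swirl u)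

/-- `ω^θ/r`, the smooth radial quotient of the swirl of the vorticity `swirl (curl u) = r ω^θ`
(Hou–Li's `ω₁`, Lei–Zhang's `Ω`, KNSS's `f`). [folklore] -/
def angVortQuot (u : EuclideanSpace ℝ (Fin 3) → EuclideanSpace ℝ (Fin 3)) :
    EuclideanSpace ℝ (Fin 3) → ℝ :=
  radQuot (swirl (curl u))

/-- `u^r/r`, the smooth radial quotient of the radial momentum `x₀u₀ + x₁u₁ = r u^r`
(Lei–Zhang's `v^r/r`; Hou–Li's `−∂_zψ₁`). [folklore] -/
def radVelQuot (u : EuclideanSpace ℝ (Fin 3) → EuclideanSpace ℝ (Fin 3)) :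
    EuclideanSpace ℝ (Fin 3) → ℝ :=
  radQuot fun x => x 0 * u x 0 + x 1 * u x 1

/-- `r² · (u^θ/r) = Γ` everywhere, for an axisymmetric `u ∈ C²`. [folklore] -/
theorem IsAxisymmetric.cylRadius_sq_mul_angVelQuot (hax : IsAxisymmetric u) (hu : ContDiff ℝ 2 u)
    (x : EuclideanSpace ℝ (Fin 3)) : cylRadius x ^ 2 * angVelQuot u x = swirl u x :=
  hax.cylRadius_sq_mul_radQuot_swirl hu x

/-- `r² · (ω^θ/r) = swirl (curl u)` everywhere, for an axisymmetric `u ∈ C³`. [folklore] -/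
theorem IsAxisymmetric.cylRadius_sq_mul_angVortQuot (hax : IsAxisymmetric u) (hu : ContDiff ℝ 3 u)
    (x : EuclideanSpace ℝ (Fin 3)) :
    cylRadius x ^ 2 * angVortQuot u x = swirl (FluidPDE.curl u) x :=
  hax.cylRadius_sq_mul_radQuot_swirl_curl hu x

/-- `r² · (u^r/r) = x₀u₀ + x₁u₁` everywhere, for an axisymmetric `u ∈ C²`. [folklore] -/
theorem IsAxisymmetric.cylRadius_sq_mul_radVelQuot (hax : IsAxisymmetric u) (hu : ContDiff ℝ 2 u)
    (x : EuclideanSpace ℝ (Fin 3)) :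
    cylRadius x ^ 2 * radVelQuot u x = x 0 * u x 0 + x 1 * u x 1 :=
  hax.cylRadius_sq_mul_radQuot_horizontal_inner hu x

/-- Smoothness: `u ∈ Cⁿ⁺² ⇒ u^θ/r ∈ Cⁿ`. [folklore] -/
theorem contDiff_angVelQuot {n : ℕ∞} (hu : ContDiff ℝ ((n + 1 : ℕ∞) + 1) u) :
    ContDiff ℝ n (angVelQuot u) :=
  contDiff_radQuot (contDiff_swirl hu)

/-- Smoothness: `u ∈ Cⁿ⁺³ ⇒ ω^θ/r ∈ Cⁿ`. [folklore] -/
theorem contDiff_angVortQuot {n : ℕ∞} (hu : ContDiff ℝ ((n + 1 + 1 : ℕ∞) + 1) u) :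
    ContDiff ℝ n (angVortQuot u) :=
  contDiff_radQuot (contDiff_swirl (contDiff_curl hu))

/-- Smoothness: `u ∈ Cⁿ⁺² ⇒ u^r/r ∈ Cⁿ`. [folklore] -/
theorem contDiff_radVelQuot {n : ℕ∞} (hu : ContDiff ℝ ((n + 1 : ℕ∞) + 1) u) :
    ContDiff ℝ n (radVelQuot u) :=
  contDiff_radQuot (contDiff_horizontal_inner hu)

/-- `u^θ/r` is an axisymmetric scalar. [folklore] -/
theorem IsAxisymmetric.isAxisymmetricScalar_angVelQuot (hax : IsAxisymmetric u)
    (hu : ContDiff ℝ 2 u) : IsAxisymmetricScalar (angVelQuot u) :=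
  isAxisymmetricScalar_radQuot (contDiff_swirl hu) hax.isAxisymmetricScalar_swirl

/-- `ω^θ/r` is an axisymmetric scalar. [folklore] -/
theorem IsAxisymmetric.isAxisymmetricScalar_angVortQuot (hax : IsAxisymmetric u)
    (hu : ContDiff ℝ 3 u) : IsAxisymmetricScalar (angVortQuot u) :=
  isAxisymmetricScalar_radQuot (contDiff_swirl (contDiff_curl (n := 2) (by exact_mod_cast hu)))
    (hax.isAxisymmetricScalar_swirl_curl (hu.differentiable (by norm_num)))

/-- `u^r/r` is an axisymmetric scalar. [folklore] -/
theorem IsAxisymmetric.isAxisymmetricScalar_radVelQuot (hax : IsAxisymmetric u)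
    (hu : ContDiff ℝ 2 u) : IsAxisymmetricScalar (radVelQuot u) :=
  isAxisymmetricScalar_radQuot (contDiff_horizontal_inner hu)
    hax.isAxisymmetricScalar_horizontal_inner

end Defs

/-! ### Calculus along coordinate lines -/

section Lines

variable {f : EuclideanSpace ℝ (Fin 3) → ℝ}

/-- The derivative of `s ↦ f (x + s v)` is the directional derivative at the moving point.
[folklore] -/
theorem hasDerivAt_along_line {x v : EuclideanSpace ℝ (Fin 3)} {s : ℝ}
    (hf : DifferentiableAt ℝ f (x + s • v)) :
    HasDerivAt (fun s : ℝ => f (x + s • v)) (fderiv ℝ f (x + s • v) v) s := by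
  have hl : HasDerivAt (fun s : ℝ => x + s • v) v s := by
    simpa using ((hasDerivAt_id s).smul_const v).const_add x
  have h := hf.hasFDerivAt.comp_hasDerivAt s hl
  exact h

/-- For `f` differentiable everywhere, `deriv (s ↦ f (x + s v)) = s ↦ ∂ᵥf (x + s v)`. [folklore] -/
theorem deriv_along_line (hf : Differentiable ℝ f) (x v : EuclideanSpace ℝ (Fin 3)) :
    deriv (fun s : ℝ => f (x + s • v)) = fun s => fderiv ℝ f (x + s • v) v :=
  funext fun _ => (hasDerivAt_along_line (hf _)).deriv

/-- `∂ᵥf (x) = (d/ds) f(x + s v) |_{s=0}`. [folklore] -/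
theorem fderiv_apply_eq_deriv_along_line (hf : Differentiable ℝ f)
    (x v : EuclideanSpace ℝ (Fin 3)) :
    fderiv ℝ f x v = deriv (fun s : ℝ => f (x + s • v)) 0 := by
  rw [deriv_along_line hf]; simp

/-- `∂ᵥ∂ᵥf (x) = (d²/ds²) f(x + s v) |_{s=0}` for `f ∈ C²`. [folklore] -/
theorem fderiv_fderiv_apply_eq_deriv_deriv_along_line (hf : ContDiff ℝ 2 f)
    (x v : EuclideanSpace ℝ (Fin 3)) :
    fderiv ℝ (fun y => fderiv ℝ f y v) x v =
      deriv (deriv fun s : ℝ => f (x + s • v)) 0 := by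
  have hd : Differentiable ℝ f := hf.differentiable two_ne_zero
  have hd1 : Differentiable ℝ fun y => fderiv ℝ f y v :=
    (contDiff_fderiv_apply_const_succ (n := 1) (by exact_mod_cast hf) v).differentiable one_ne_zero
  rw [deriv_along_line hd, fderiv_apply_eq_deriv_along_line hd1]

end Lines


/-! ### Pointwise calculus helpers -/

section Helpers

variable {w : EuclideanSpace ℝ (Fin 3) → EuclideanSpace ℝ (Fin 3)}

/-- Derivative of a coordinate of a vector field: `D(wᵢ)(x) h = (Dw(x) h)ᵢ`. [folklore] -/
theorem fderiv_apply_coord_vec3 {x : EuclideanSpace ℝ (Fin 3)} (hw : DifferentiableAt ℝ w x) (i : Fin 3)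
    (h : EuclideanSpace ℝ (Fin 3)) :
    fderiv ℝ (fun y => w y i) x h = fderiv ℝ w x h i := by
  have hc := ((EuclideanSpace.proj (𝕜 := ℝ) i).hasFDerivAt.comp x hw.hasFDerivAt).fderiv
  have hfun : (fun y => w y i) = (EuclideanSpace.proj (𝕜 := ℝ) i) ∘ w := rfl
  rw [hfun, hc]
  rfl

/-- A coordinate of a `Cⁿ` vector field is `Cⁿ`. [folklore] -/
theorem contDiff_apply_coord_vec3 {n : WithTop ℕ∞} (hw : ContDiff ℝ n w) (i : Fin 3) :
    ContDiff ℝ n fun y => w y i :=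
  (contDiff_piLp_apply (𝕜 := ℝ) (p := 2) (n := n) (i := i)).comp hw

/-- Mixed second directional derivatives of a `C²` vector field commute:
`∂_b (∂_a w) = ∂_a (∂_b w)`. [folklore] -/
theorem fderiv_fderiv_apply_comm_vec (hw : ContDiff ℝ 2 w) (x a b : EuclideanSpace ℝ (Fin 3)) :
    fderiv ℝ (fun y => fderiv ℝ w y a) x b = fderiv ℝ (fun y => fderiv ℝ w y b) x a := by
  have hd : DifferentiableAt ℝ (fderiv ℝ w) x :=
    ((hw.fderiv_right (m := 1) (by norm_num)).differentiable one_ne_zero) x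
  rw [fderiv_clm_apply hd (differentiableAt_const a),
    fderiv_clm_apply hd (differentiableAt_const b)]
  simp only [fderiv_fun_const, Pi.zero_apply, ContinuousLinearMap.comp_zero, zero_add,
    ContinuousLinearMap.flip_apply]
  exact (hw.contDiffAt.isSymmSndFDerivAt (by simp)) b a

end Helpers

/-! ### Axisymmetric fields on the meridian plane `{x₁ = 0}` -/

section Meridian

variable {u : EuclideanSpace ℝ (Fin 3) → EuclideanSpace ℝ (Fin 3)}

/-- **Infinitesimal axisymmetry on the meridian plane**: `x₀ ∂₁u (x) = J u(x)` for `x₁ = 0`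
(`Du(x)[Jx] = J u(x)` with `Jx = x₀e₁`). [folklore] -/
theorem IsAxisymmetric.smul_fderiv_single_one (hax : IsAxisymmetric u) (hd : Differentiable ℝ u)
    {x : EuclideanSpace ℝ (Fin 3)} (hx : x 1 = 0) :
    (x 0) • fderiv ℝ u x (EuclideanSpace.single 1 1) = rotGen (u x) := by
  have h := hax.fderiv_rotGen (hd x)
  rwa [rotGen_eq_sub_single, hx, zero_smul, sub_zero, map_smul] at h

/-- Component `1`: `x₀ ∂₁u₁ = u₀` on the meridian plane. [folklore] -/
theorem IsAxisymmetric.mul_fderiv_single_one_apply_one (hax : IsAxisymmetric u)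
    (hd : Differentiable ℝ u) {x : EuclideanSpace ℝ (Fin 3)} (hx : x 1 = 0) :
    x 0 * fderiv ℝ u x (EuclideanSpace.single 1 1) 1 = u x 0 := by
  have h := congrArg (fun v : EuclideanSpace ℝ (Fin 3) => v 1) (hax.smul_fderiv_single_one hd hx)
  simpa using h

/-- On the axis the horizontal velocity of an axisymmetric field vanishes: `u₀ = 0`. [folklore] -/
theorem IsAxisymmetric.apply_zero_eq_zero_of_axis (hax : IsAxisymmetric u) (hd : Differentiable ℝ u)
    {x : EuclideanSpace ℝ (Fin 3)} (h0 : x 0 = 0) (h1 : x 1 = 0) : u x 0 = 0 := by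
  have h := hax.mul_fderiv_single_one_apply_one hd h1
  rw [h0, zero_mul] at h
  exact h.symm

/-- On the axis the horizontal velocity of an axisymmetric field vanishes: `u₁ = 0`. [folklore] -/
theorem IsAxisymmetric.apply_one_eq_zero_of_axis (hax : IsAxisymmetric u) (hd : Differentiable ℝ u)
    {x : EuclideanSpace ℝ (Fin 3)} (h0 : x 0 = 0) (h1 : x 1 = 0) : u x 1 = 0 := by
  have h := congrArg (fun v : EuclideanSpace ℝ (Fin 3) => v 0) (hax.smul_fderiv_single_one hd h1)
  simp only [PiLp.smul_apply, smul_eq_mul, rotGen_apply_zero, h0, zero_mul] at h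
  linarith

/-- **`u^r/r` on the meridian plane**: `x₀ · radVelQuot u x = u₀ x` for `x₁ = 0` (also on the
axis, where both sides vanish). [folklore] -/
theorem IsAxisymmetric.mul_radVelQuot_of_meridian (hax : IsAxisymmetric u) (hu : ContDiff ℝ 2 u)
    {x : EuclideanSpace ℝ (Fin 3)} (hx : x 1 = 0) : x 0 * radVelQuot u x = u x 0 := by
  have hd : Differentiable ℝ u := hu.differentiable two_ne_zero
  have h := hax.cylRadius_sq_mul_radVelQuot hu x
  rw [cylRadius_sq, hx] at h
  simp only [ne_eq, OfNat.ofNat_ne_zero, not_false_eq_true, zero_pow, add_zero, zero_mul] at h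
  -- `h : x0² ρ = x0 u0`
  by_cases h0 : x 0 = 0
  · rw [h0, zero_mul, hax.apply_zero_eq_zero_of_axis hd h0 hx]
  · apply mul_left_cancel₀ h0
    rw [← mul_assoc, ← pow_two, h]

/-- The swirl of the vorticity on the meridian plane: `swirl (curl u) x = x₀ (curl u x)₁`,
and `(curl u x)₁ = ∂₂u₀ − ∂₀u₂`. [folklore] -/
theorem curl_apply_one_eq_sub (u : EuclideanSpace ℝ (Fin 3) → EuclideanSpace ℝ (Fin 3))
    (x : EuclideanSpace ℝ (Fin 3)) :
    FluidPDE.curl u x 1 = fderiv ℝ u x (EuclideanSpace.single 2 1) 0 -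
      fderiv ℝ u x (EuclideanSpace.single 0 1) 2 := by
  simp [FluidPDE.curl]

/-- **`ω^θ/r` on the meridian plane**: `x₀ · angVortQuot u x = (curl u x)₁` for `x₁ = 0`.
[folklore] -/
theorem IsAxisymmetric.mul_angVortQuot_of_meridian (hax : IsAxisymmetric u) (hu : ContDiff ℝ 3 u)
    {x : EuclideanSpace ℝ (Fin 3)} (hx : x 1 = 0) :
    x 0 * angVortQuot u x = FluidPDE.curl u x 1 := by
  have hd : Differentiable ℝ u := hu.differentiable (by norm_num)
  have hω : IsAxisymmetric (FluidPDE.curl u) := hax.curl hd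
  have hωd : Differentiable ℝ (FluidPDE.curl u) :=
    (contDiff_curl (n := 2) (by exact_mod_cast hu)).differentiable two_ne_zero
  have h := hax.cylRadius_sq_mul_angVortQuot hu x
  rw [cylRadius_sq, hx, swirl, hx] at h
  simp only [ne_eq, OfNat.ofNat_ne_zero, not_false_eq_true, zero_pow, add_zero, zero_mul,
    sub_zero] at h
  -- `h : x0² ω₁ = x0 (curl u x)₁`
  by_cases h0 : x 0 = 0
  · rw [h0, zero_mul, hω.apply_one_eq_zero_of_axis hωd h0 hx]
  · apply mul_left_cancel₀ h0
    rw [← mul_assoc, ← pow_two, h]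

/-- **The `e₀`-derivative of the infinitesimal axisymmetry on the meridian plane**, component `1`:
`x₀ ∂₀∂₁u₁ + ∂₁u₁ = ∂₀u₀` at `x` with `x₁ = 0` (differentiate `Du(y)[Jy] − J u(y) ≡ 0` along
`e₀`). [folklore] -/
theorem IsAxisymmetric.mul_fderiv_fderiv_one_one (hax : IsAxisymmetric u) (hu : ContDiff ℝ 2 u)
    {x : EuclideanSpace ℝ (Fin 3)} (hx : x 1 = 0) :
    x 0 * fderiv ℝ (fun y => fderiv ℝ u y (EuclideanSpace.single 1 1) 1) x
        (EuclideanSpace.single 0 1) +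
      fderiv ℝ u x (EuclideanSpace.single 1 1) 1 =
      fderiv ℝ u x (EuclideanSpace.single 0 1) 0 := by
  have hud : Differentiable ℝ u := hu.differentiable two_ne_zero
  have hdg : DifferentiableAt ℝ (fderiv ℝ u) x :=
    ((hu.fderiv_right (m := 1) (by norm_num)).differentiable one_ne_zero) x
  -- the identity `Du(y)[Jy] = J u(y)` as functions
  have hΦ : (fun z : EuclideanSpace ℝ (Fin 3) => fderiv ℝ u z (rotGenL z)) =
      fun z => rotGenL (u z) := funext fun z => by
    rw [rotGenL_apply, rotGenL_apply]; exact hax.fderiv_rotGen (hud z)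
  have h1 : HasFDerivAt (fun z : EuclideanSpace ℝ (Fin 3) => fderiv ℝ u z (rotGenL z))
      ((fderiv ℝ u x).comp rotGenL + (fderiv ℝ (fderiv ℝ u) x).flip (rotGenL x)) x :=
    hdg.hasFDerivAt.clm_apply rotGenL.hasFDerivAt
  have h2 : HasFDerivAt (fun z : EuclideanSpace ℝ (Fin 3) => rotGenL (u z))
      (rotGenL.comp (fderiv ℝ u x)) x :=
    rotGenL.hasFDerivAt.comp x (hud x).hasFDerivAt
  rw [hΦ] at h1
  have h3 := congrArg (fun T : EuclideanSpace ℝ (Fin 3) →L[ℝ] EuclideanSpace ℝ (Fin 3) =>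
    T (EuclideanSpace.single 0 1) 1) (h1.unique h2)
  simp only [_root_.add_apply, ContinuousLinearMap.comp_apply,
    ContinuousLinearMap.flip_apply, rotGenL_apply, PiLp.add_apply] at h3
  rw [rotGen_single_zero, rotGen_eq_sub_single, hx, zero_smul, sub_zero, map_smul,
    rotGen_apply_one] at h3
  -- `h3 : ∂₁u x 1 + (x0 • D²u x e0 e1) 1 = (Du x e0) 0`
  have h4 : fderiv ℝ (fun y => fderiv ℝ u y (EuclideanSpace.single 1 1) 1) x
      (EuclideanSpace.single 0 1) =
      fderiv ℝ (fderiv ℝ u) x (EuclideanSpace.single 0 1) (EuclideanSpace.single 1 1) 1 := by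
    have hw : DifferentiableAt ℝ (fun y => fderiv ℝ u y (EuclideanSpace.single 1 1)) x :=
      (contDiff_fderiv_apply_const_succ (n := 1) (by exact_mod_cast hu) _).differentiable
        one_ne_zero x
    rw [fderiv_apply_coord_vec3 hw, fderiv_clm_apply hdg (differentiableAt_const _)]
    simp
  rw [h4]
  have h5 : ((x 0) • fderiv ℝ (fderiv ℝ u) x (EuclideanSpace.single 0 1)
      (EuclideanSpace.single 1 1)) 1 =
      x 0 * fderiv ℝ (fderiv ℝ u) x (EuclideanSpace.single 0 1) (EuclideanSpace.single 1 1) 1 := by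
    simp
  linarith [h3, h5]

/-- **Divergence in components**: `∂₀u₀ + ∂₁u₁ + ∂₂u₂ = div u`. [folklore] -/
theorem divergence_eq_sum_three (u : EuclideanSpace ℝ (Fin 3) → EuclideanSpace ℝ (Fin 3))
    (x : EuclideanSpace ℝ (Fin 3)) :
    VectorCalculus.divergence u x = fderiv ℝ u x (EuclideanSpace.single 0 1) 0 +
      fderiv ℝ u x (EuclideanSpace.single 1 1) 1 + fderiv ℝ u x (EuclideanSpace.single 2 1) 2 := by
  rw [divergence_eq_sum_inner_fderiv (EuclideanSpace.basisFun (Fin 3) ℝ)]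
  simp [Fin.sum_univ_three, EuclideanSpace.inner_single_left]

/-- **The `e₀`-derivative of `div u = 0`**: `∂₀∂₀u₀ + ∂₀∂₁u₁ + ∂₀∂₂u₂ = 0` for a divergence-free
`u ∈ C²`. [folklore] -/
theorem fderiv_divergence_components_eq_zero (hu : ContDiff ℝ 2 u)
    (hdiv : VectorCalculus.IsDivFree u) (x v : EuclideanSpace ℝ (Fin 3)) :
    fderiv ℝ (fun y => fderiv ℝ u y (EuclideanSpace.single 0 1) 0) x v +
      fderiv ℝ (fun y => fderiv ℝ u y (EuclideanSpace.single 1 1) 1) x v +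
      fderiv ℝ (fun y => fderiv ℝ u y (EuclideanSpace.single 2 1) 2) x v = 0 := by
  have hdi : ∀ i : Fin 3, Differentiable ℝ fun y => fderiv ℝ u y (EuclideanSpace.single i 1) i :=
    fun i => (contDiff_apply_coord_vec3 (contDiff_fderiv_apply_const_succ (n := 1)
      (by exact_mod_cast hu) _) i).differentiable one_ne_zero
  have hfun : (fun y => fderiv ℝ u y (EuclideanSpace.single 0 1) 0 +
      fderiv ℝ u y (EuclideanSpace.single 1 1) 1 + fderiv ℝ u y (EuclideanSpace.single 2 1) 2) =
      fun _ => (0 : ℝ) := funext fun y => by rw [← divergence_eq_sum_three]; exact hdiv y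
  have h : fderiv ℝ (fun y => fderiv ℝ u y (EuclideanSpace.single 0 1) 0 +
      fderiv ℝ u y (EuclideanSpace.single 1 1) 1 + fderiv ℝ u y (EuclideanSpace.single 2 1) 2) x v =
      0 := by
    rw [hfun]; simp
  rw [fderiv_fun_add ((hdi 0 x).fun_add (hdi 1 x)) (hdi 2 x), fderiv_fun_add (hdi 0 x) (hdi 1 x)]
    at h
  simpa using h

end Meridian


/-! ### The elliptic identity `Δ(u^r/r) + (2/r)∂ᵣ(u^r/r) = ∂_z(ω^θ/r)` -/

section Identity

variable {u : EuclideanSpace ℝ (Fin 3) → EuclideanSpace ℝ (Fin 3)}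

/-- Coordinates of points on the coordinate lines through `x`. [folklore] -/
theorem line_single_apply (x : EuclideanSpace ℝ (Fin 3)) (s : ℝ) (i j : Fin 3) :
    (x + s • EuclideanSpace.single i (1 : ℝ)) j = x j + if j = i then s else 0 := by
  by_cases h : j = i
  · subst h; simp
  · simp [h]

/-- **The identity at meridian points off the axis.** For an axisymmetric divergence-free
`u ∈ C⁴` and `x` with `x₁ = 0`, `x₀ ≠ 0`:
`Δ(u^r/r)(x) + 2 radDerivQuot (u^r/r)(x) = ∂₂(ω^θ/r)(x)`. Proof in the module docstring:
restrict `x₀ · (u^r/r) = u₀` to the lines through `x` along `e₀` and `e₂`, use the cylindrical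
Laplacian `∂₀² + (1/x₀)∂₀ + ∂₂²` of axisymmetric scalars, `x₀ · (ω^θ/r) = ∂₂u₀ − ∂₀u₂`, and
`∂₀(div u) = 0` together with `∂₁u₁ = u₀/x₀`, `x₀∂₀∂₁u₁ = ∂₀u₀ − ∂₁u₁` on the meridian plane.
[cite: LeiZhang2017, Lemma 2.1 (the relation between v^r/r and Ω)] -/
theorem IsAxisymmetric.laplacian_radVelQuot_add_of_meridian (hax : IsAxisymmetric u)
    (hu : ContDiff ℝ 4 u) (hdiv : VectorCalculus.IsDivFree u) {x : EuclideanSpace ℝ (Fin 3)}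
    (hx1 : x 1 = 0) (hx0 : x 0 ≠ 0) :
    (Δ (radVelQuot u)) x + 2 * radDerivQuot (radVelQuot u) x =
      fderiv ℝ (angVortQuot u) x (EuclideanSpace.single 2 1) := by
  -- regularity
  have hu2 : ContDiff ℝ 2 u := hu.of_le (by norm_num)
  have hu3 : ContDiff ℝ 3 u := hu.of_le (by norm_num)
  have hud : Differentiable ℝ u := hu.differentiable (by norm_num)
  have hρ2 : ContDiff ℝ 2 (radVelQuot u) :=
    contDiff_radVelQuot (n := 2) (by exact_mod_cast hu)
  have hρd : Differentiable ℝ (radVelQuot u) := hρ2.differentiable two_ne_zero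
  have hρax : IsAxisymmetricScalar (radVelQuot u) := hax.isAxisymmetricScalar_radVelQuot hu2
  have hω1 : ContDiff ℝ 1 (angVortQuot u) :=
    contDiff_angVortQuot (n := 1) (by exact_mod_cast hu)
  have hωd : Differentiable ℝ (angVortQuot u) := hω1.differentiable one_ne_zero
  have hdρ0 : Differentiable ℝ fun y => fderiv ℝ (radVelQuot u) y (EuclideanSpace.single 0 1) :=
    (contDiff_fderiv_apply_const_succ (n := 1) (by exact_mod_cast hρ2) _).differentiable
      one_ne_zero
  have hdρ2 : Differentiable ℝ fun y => fderiv ℝ (radVelQuot u) y (EuclideanSpace.single 2 1) :=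
    (contDiff_fderiv_apply_const_succ (n := 1) (by exact_mod_cast hρ2) _).differentiable
      one_ne_zero
  have hdu : ∀ (v : EuclideanSpace ℝ (Fin 3)) (i : Fin 3),
      Differentiable ℝ fun y => fderiv ℝ u y v i := fun v i =>
    (contDiff_apply_coord_vec3 (contDiff_fderiv_apply_const_succ (n := 1) (by exact_mod_cast hu2) v)
      i).differentiable one_ne_zero
  have hdu0 : ∀ i : Fin 3, Differentiable ℝ fun y => u y i := fun i =>
    (contDiff_apply_coord_vec3 hu2 i).differentiable two_ne_zero
  -- coordinates on the two lines through `x`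
  have l0_0 : ∀ s : ℝ, (x + s • EuclideanSpace.single (0 : Fin 3) (1 : ℝ)) 0 = x 0 + s :=
    fun s => by rw [line_single_apply]; simp
  have l0_1 : ∀ s : ℝ, (x + s • EuclideanSpace.single (0 : Fin 3) (1 : ℝ)) 1 = 0 :=
    fun s => by rw [line_single_apply, hx1]; simp
  have l2_0 : ∀ s : ℝ, (x + s • EuclideanSpace.single (2 : Fin 3) (1 : ℝ)) 0 = x 0 :=
    fun s => by rw [line_single_apply]; simp
  have l2_1 : ∀ s : ℝ, (x + s • EuclideanSpace.single (2 : Fin 3) (1 : ℝ)) 1 = 0 :=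
    fun s => by rw [line_single_apply, hx1]; simp
  /- (1) the line through `x` along `e₀`: `(x₀ + s) ρ = u₀` -/
  have hgU : (fun s : ℝ => (x 0 + s) * radVelQuot u (x + s • EuclideanSpace.single 0 1)) =
      fun s => u (x + s • EuclideanSpace.single 0 1) 0 := funext fun s => by
    have h := hax.mul_radVelQuot_of_meridian hu2 (l0_1 s)
    rwa [l0_0] at h
  -- first derivatives along the line
  have hg1 : ∀ s : ℝ, HasDerivAt (fun s : ℝ => radVelQuot u (x + s • EuclideanSpace.single 0 1))
      (fderiv ℝ (radVelQuot u) (x + s • EuclideanSpace.single 0 1) (EuclideanSpace.single 0 1)) s :=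
    fun s => hasDerivAt_along_line (hρd _)
  have hU1 : ∀ s : ℝ, HasDerivAt (fun s : ℝ => u (x + s • EuclideanSpace.single 0 1) 0)
      (fderiv ℝ (fun y => u y 0) (x + s • EuclideanSpace.single 0 1) (EuclideanSpace.single 0 1))
      s := fun s => hasDerivAt_along_line (f := fun y => u y 0) (hdu0 0 _)
  have hprod : ∀ s : ℝ, HasDerivAt (fun s : ℝ => u (x + s • EuclideanSpace.single 0 1) 0)
      (1 * radVelQuot u (x + s • EuclideanSpace.single 0 1) + (x 0 + s) *
        fderiv ℝ (radVelQuot u) (x + s • EuclideanSpace.single 0 1) (EuclideanSpace.single 0 1))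
      s := fun s => by
    rw [← hgU]
    exact ((hasDerivAt_id s).const_add (x 0)).mul (hg1 s)
  have hR1fun : (fun s : ℝ => fderiv ℝ (fun y => u y 0) (x + s • EuclideanSpace.single 0 1)
      (EuclideanSpace.single 0 1)) = fun s => 1 * radVelQuot u (x + s • EuclideanSpace.single 0 1) +
      (x 0 + s) * fderiv ℝ (radVelQuot u) (x + s • EuclideanSpace.single 0 1)
        (EuclideanSpace.single 0 1) := funext fun s => (hU1 s).unique (hprod s)
  -- second derivatives along the line
  have hG1 : ∀ s : ℝ, HasDerivAt (fun s : ℝ => fderiv ℝ (radVelQuot u)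
      (x + s • EuclideanSpace.single 0 1) (EuclideanSpace.single 0 1))
      (fderiv ℝ (fun y => fderiv ℝ (radVelQuot u) y (EuclideanSpace.single 0 1))
        (x + s • EuclideanSpace.single 0 1) (EuclideanSpace.single 0 1)) s := fun s =>
    hasDerivAt_along_line (f := fun y => fderiv ℝ (radVelQuot u) y (EuclideanSpace.single 0 1))
      (hdρ0 _)
  have hV1 : ∀ s : ℝ, HasDerivAt (fun s : ℝ => fderiv ℝ (fun y => u y 0)
      (x + s • EuclideanSpace.single 0 1) (EuclideanSpace.single 0 1))
      (fderiv ℝ (fun y => fderiv ℝ (fun y => u y 0) y (EuclideanSpace.single 0 1))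
        (x + s • EuclideanSpace.single 0 1) (EuclideanSpace.single 0 1)) s := fun s => by
    refine hasDerivAt_along_line (f := fun y => fderiv ℝ (fun y => u y 0) y
      (EuclideanSpace.single 0 1)) ?_
    have hfun : (fun y => fderiv ℝ (fun y => u y 0) y (EuclideanSpace.single 0 1)) =
        fun y => fderiv ℝ u y (EuclideanSpace.single 0 1) 0 :=
      funext fun y => fderiv_apply_coord_vec3 (hud y) 0 _
    rw [hfun]
    exact hdu _ 0 _
  have hprod2 : HasDerivAt (fun s : ℝ => fderiv ℝ (fun y => u y 0)
      (x + s • EuclideanSpace.single 0 1) (EuclideanSpace.single 0 1))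
      (1 * fderiv ℝ (radVelQuot u) (x + (0 : ℝ) • EuclideanSpace.single 0 1)
          (EuclideanSpace.single 0 1) +
        (1 * fderiv ℝ (radVelQuot u) (x + (0 : ℝ) • EuclideanSpace.single 0 1)
          (EuclideanSpace.single 0 1) + (x 0 + id (0 : ℝ)) *
          fderiv ℝ (fun y => fderiv ℝ (radVelQuot u) y (EuclideanSpace.single 0 1))
            (x + (0 : ℝ) • EuclideanSpace.single 0 1) (EuclideanSpace.single 0 1))) 0 := by
    rw [hR1fun]
    exact ((hg1 0).const_mul 1).add (((hasDerivAt_id (0 : ℝ)).const_add (x 0)).mul (hG1 0))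
  have hR2 := (hV1 0).unique hprod2
  have hR1 := congrFun hR1fun 0
  simp only [zero_smul, add_zero, one_mul, id_eq] at hR1 hR2
  -- rewrite the `u₀`-derivatives as components of derivatives of `u`
  have hcoord1 : fderiv ℝ (fun y => u y 0) x (EuclideanSpace.single 0 1) =
      fderiv ℝ u x (EuclideanSpace.single 0 1) 0 := fderiv_apply_coord_vec3 (hud x) 0 _
  have hcoord2 : fderiv ℝ (fun y => fderiv ℝ (fun y => u y 0) y (EuclideanSpace.single 0 1)) x
      (EuclideanSpace.single 0 1) =
      fderiv ℝ (fun y => fderiv ℝ u y (EuclideanSpace.single 0 1) 0) x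
        (EuclideanSpace.single 0 1) := by
    have hfun : (fun y => fderiv ℝ (fun y => u y 0) y (EuclideanSpace.single 0 1)) =
        fun y => fderiv ℝ u y (EuclideanSpace.single 0 1) 0 :=
      funext fun y => fderiv_apply_coord_vec3 (hud y) 0 _
    rw [hfun]
  rw [hcoord1] at hR1
  rw [hcoord2] at hR2
  /- (2) the line through `x` along `e₂`: `x₀ ρ = u₀` -/
  have hhW : (fun s : ℝ => x 0 * radVelQuot u (x + s • EuclideanSpace.single 2 1)) =
      fun s => u (x + s • EuclideanSpace.single 2 1) 0 := funext fun s => by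
    have h := hax.mul_radVelQuot_of_meridian hu2 (l2_1 s)
    rwa [l2_0] at h
  have hh1 : ∀ s : ℝ, HasDerivAt (fun s : ℝ => radVelQuot u (x + s • EuclideanSpace.single 2 1))
      (fderiv ℝ (radVelQuot u) (x + s • EuclideanSpace.single 2 1) (EuclideanSpace.single 2 1)) s :=
    fun s => hasDerivAt_along_line (hρd _)
  have hW1 : ∀ s : ℝ, HasDerivAt (fun s : ℝ => u (x + s • EuclideanSpace.single 2 1) 0)
      (fderiv ℝ (fun y => u y 0) (x + s • EuclideanSpace.single 2 1) (EuclideanSpace.single 2 1))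
      s := fun s => hasDerivAt_along_line (f := fun y => u y 0) (hdu0 0 _)
  have hS1fun : (fun s : ℝ => fderiv ℝ (fun y => u y 0) (x + s • EuclideanSpace.single 2 1)
      (EuclideanSpace.single 2 1)) = fun s => x 0 * fderiv ℝ (radVelQuot u)
      (x + s • EuclideanSpace.single 2 1) (EuclideanSpace.single 2 1) := funext fun s => by
    refine (hW1 s).unique ?_
    rw [← hhW]
    exact (hh1 s).const_mul (x 0)
  have hH1 : HasDerivAt (fun s : ℝ => fderiv ℝ (radVelQuot u)
      (x + s • EuclideanSpace.single 2 1) (EuclideanSpace.single 2 1))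
      (fderiv ℝ (fun y => fderiv ℝ (radVelQuot u) y (EuclideanSpace.single 2 1))
        (x + (0 : ℝ) • EuclideanSpace.single 2 1) (EuclideanSpace.single 2 1)) 0 :=
    hasDerivAt_along_line (f := fun y => fderiv ℝ (radVelQuot u) y (EuclideanSpace.single 2 1))
      (hdρ2 _)
  have hX1 : HasDerivAt (fun s : ℝ => fderiv ℝ (fun y => u y 0)
      (x + s • EuclideanSpace.single 2 1) (EuclideanSpace.single 2 1))
      (fderiv ℝ (fun y => fderiv ℝ (fun y => u y 0) y (EuclideanSpace.single 2 1))
        (x + (0 : ℝ) • EuclideanSpace.single 2 1) (EuclideanSpace.single 2 1)) 0 := by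
    refine hasDerivAt_along_line (f := fun y => fderiv ℝ (fun y => u y 0) y
      (EuclideanSpace.single 2 1)) ?_
    have hfun : (fun y => fderiv ℝ (fun y => u y 0) y (EuclideanSpace.single 2 1)) =
        fun y => fderiv ℝ u y (EuclideanSpace.single 2 1) 0 :=
      funext fun y => fderiv_apply_coord_vec3 (hud y) 0 _
    rw [hfun]
    exact hdu _ 0 _
  have hprod3 : HasDerivAt (fun s : ℝ => fderiv ℝ (fun y => u y 0)
      (x + s • EuclideanSpace.single 2 1) (EuclideanSpace.single 2 1))
      (x 0 * fderiv ℝ (fun y => fderiv ℝ (radVelQuot u) y (EuclideanSpace.single 2 1))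
        (x + (0 : ℝ) • EuclideanSpace.single 2 1) (EuclideanSpace.single 2 1)) 0 := by
    rw [hS1fun]
    exact hH1.const_mul (x 0)
  have hR3 := hX1.unique hprod3
  have hcoord3 : fderiv ℝ (fun y => fderiv ℝ (fun y => u y 0) y (EuclideanSpace.single 2 1)) x
      (EuclideanSpace.single 2 1) =
      fderiv ℝ (fun y => fderiv ℝ u y (EuclideanSpace.single 2 1) 0) x
        (EuclideanSpace.single 2 1) := by
    have hfun : (fun y => fderiv ℝ (fun y => u y 0) y (EuclideanSpace.single 2 1)) =
        fun y => fderiv ℝ u y (EuclideanSpace.single 2 1) 0 :=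
      funext fun y => fderiv_apply_coord_vec3 (hud y) 0 _
    rw [hfun]
  simp only [zero_smul, add_zero] at hR3
  rw [hcoord3] at hR3
  /- (3) the line through `x` along `e₂` for `ω^θ/r`: `x₀ ω₁ = ∂₂u₀ − ∂₀u₂` -/
  have hkC : (fun s : ℝ => x 0 * angVortQuot u (x + s • EuclideanSpace.single 2 1)) =
      fun s => fderiv ℝ u (x + s • EuclideanSpace.single 2 1) (EuclideanSpace.single 2 1) 0 -
        fderiv ℝ u (x + s • EuclideanSpace.single 2 1) (EuclideanSpace.single 0 1) 2 :=
    funext fun s => by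
      have h := hax.mul_angVortQuot_of_meridian hu3 (l2_1 s)
      rwa [l2_0, curl_apply_one_eq_sub] at h
  have hk1 : HasDerivAt (fun s : ℝ => x 0 * angVortQuot u (x + s • EuclideanSpace.single 2 1))
      (x 0 * fderiv ℝ (angVortQuot u) (x + (0 : ℝ) • EuclideanSpace.single 2 1)
        (EuclideanSpace.single 2 1)) 0 :=
    (hasDerivAt_along_line (hωd _)).const_mul (x 0)
  have hC1 : HasDerivAt (fun s : ℝ =>
      fderiv ℝ u (x + s • EuclideanSpace.single 2 1) (EuclideanSpace.single 2 1) 0 -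
        fderiv ℝ u (x + s • EuclideanSpace.single 2 1) (EuclideanSpace.single 0 1) 2)
      (fderiv ℝ (fun y => fderiv ℝ u y (EuclideanSpace.single 2 1) 0)
          (x + (0 : ℝ) • EuclideanSpace.single 2 1) (EuclideanSpace.single 2 1) -
        fderiv ℝ (fun y => fderiv ℝ u y (EuclideanSpace.single 0 1) 2)
          (x + (0 : ℝ) • EuclideanSpace.single 2 1) (EuclideanSpace.single 2 1)) 0 :=
    (hasDerivAt_along_line (f := fun y => fderiv ℝ u y (EuclideanSpace.single 2 1) 0)
      (hdu _ 0 _)).sub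
      (hasDerivAt_along_line (f := fun y => fderiv ℝ u y (EuclideanSpace.single 0 1) 2) (hdu _ 2 _))
  rw [hkC] at hk1
  have hR4 := hk1.unique hC1
  simp only [zero_smul, add_zero] at hR4
  /- (4) the remaining pointwise relations at `x` -/
  have hR5 := hρax.mul_fderiv_fderiv_single_one hρ2 hx1
  have hR6 := mul_radDerivQuot_eq_fderiv_zero hρ2 hρax x
  have hLB := hax.mul_fderiv_fderiv_one_one hu2 hx1
  have hLA := hax.mul_fderiv_single_one_apply_one hud hx1
  have hLE := hax.mul_radVelQuot_of_meridian hu2 hx1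
  have hLD := fderiv_divergence_components_eq_zero hu2 hdiv x (EuclideanSpace.single 0 1)
  have hSYM : fderiv ℝ (fun y => fderiv ℝ u y (EuclideanSpace.single 2 1) 2) x
      (EuclideanSpace.single 0 1) =
      fderiv ℝ (fun y => fderiv ℝ u y (EuclideanSpace.single 0 1) 2) x
        (EuclideanSpace.single 2 1) := by
    have hw2 : DifferentiableAt ℝ (fun y => fderiv ℝ u y (EuclideanSpace.single 2 1)) x :=
      (contDiff_fderiv_apply_const_succ (n := 1) (by exact_mod_cast hu2) _).differentiable
        one_ne_zero x
    have hw0 : DifferentiableAt ℝ (fun y => fderiv ℝ u y (EuclideanSpace.single 0 1)) x :=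
      (contDiff_fderiv_apply_const_succ (n := 1) (by exact_mod_cast hu2) _).differentiable
        one_ne_zero x
    rw [fderiv_apply_coord_vec3 hw2, fderiv_apply_coord_vec3 hw0, fderiv_fderiv_apply_comm_vec hu2]
  have hLap : (Δ (radVelQuot u)) x =
      fderiv ℝ (fun y => fderiv ℝ (radVelQuot u) y (EuclideanSpace.single 0 1)) x
          (EuclideanSpace.single 0 1) +
        fderiv ℝ (fun y => fderiv ℝ (radVelQuot u) y (EuclideanSpace.single 1 1)) x
          (EuclideanSpace.single 1 1) +
        fderiv ℝ (fun y => fderiv ℝ (radVelQuot u) y (EuclideanSpace.single 2 1)) x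
          (EuclideanSpace.single 2 1) := by
    rw [laplacian_eq_sum_fderiv_fderiv (EuclideanSpace.basisFun (Fin 3) ℝ) hρ2 x]
    simp only [EuclideanSpace.basisFun_apply, Fin.sum_univ_three]
  -- `∂₁u₁ = ρ` at `x`
  have hd1u1 : fderiv ℝ u x (EuclideanSpace.single 1 1) 1 = radVelQuot u x :=
    mul_left_cancel₀ hx0 (hLA.trans hLE.symm)
  -- `∂₀∂₁u₁ = ∂₀ρ` at `x`
  have hN : x 0 * fderiv ℝ (fun y => fderiv ℝ u y (EuclideanSpace.single 1 1) 1) x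
      (EuclideanSpace.single 0 1) =
      x 0 * fderiv ℝ (radVelQuot u) x (EuclideanSpace.single 0 1) := by
    linear_combination hLB + hR1 - hd1u1
  have hN' := mul_left_cancel₀ hx0 hN
  -- conclude: multiply the goal by `x₀`
  apply mul_left_cancel₀ hx0
  rw [hLap]
  linear_combination -hR2 + hR5 - hR3 + 2 * hR6 - hR4 + hLD - hSYM - hN'


/-- `R_{−θ} (R_θ x) = x`. [folklore] -/
theorem rotZ_neg_apply_rotZ (θ : ℝ) (x : EuclideanSpace ℝ (Fin 3)) : rotZ (-θ) (rotZ θ x) = x := by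
  ext i
  fin_cases i
  · simp [rotZ, Real.sin_neg, Real.cos_neg]
    linear_combination (x 0) * Real.sin_sq_add_cos_sq θ
  · simp [rotZ, Real.sin_neg, Real.cos_neg]
    linear_combination (x 1) * Real.sin_sq_add_cos_sq θ
  · simp [rotZ]

/-- The Laplacian of an axisymmetric scalar is an axisymmetric scalar. [folklore] -/
theorem IsAxisymmetricScalar.laplacian {g : EuclideanSpace ℝ (Fin 3) → ℝ}
    (hg : IsAxisymmetricScalar g) : IsAxisymmetricScalar (Δ g) := by
  intro θ x
  have hfun : (fun y => g ((rotZLIE θ).symm y)) = g := funext fun y => by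
    rw [rotZLIE_symm_apply]; exact hg (-θ) y
  have h := laplacian_comp_linearIsometryEquiv_symm (rotZLIE θ) g (rotZ θ x)
  rw [hfun, rotZLIE_symm_apply, rotZ_neg_apply_rotZ] at h
  exact h

/-- The rotations fix the axial direction: `R_θ e₂ = e₂`. [folklore] -/
theorem rotZ_apply_single_two (θ : ℝ) :
    rotZ θ (EuclideanSpace.single 2 (1 : ℝ)) = EuclideanSpace.single 2 1 := by
  ext i
  fin_cases i <;> simp [rotZ]

/-- The axial derivative of an axisymmetric scalar is an axisymmetric scalar. [folklore] -/
theorem IsAxisymmetricScalar.fderiv_apply_single_two {g : EuclideanSpace ℝ (Fin 3) → ℝ}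
    (hg : IsAxisymmetricScalar g) (hd : Differentiable ℝ g) :
    IsAxisymmetricScalar fun x => fderiv ℝ g x (EuclideanSpace.single 2 1) := by
  intro θ x
  have h := hg.fderiv_rotZ_apply_rotZ hd θ x (EuclideanSpace.single 2 1)
  rwa [rotZ_apply_single_two] at h

/-- **The elliptic identity behind Lemma 2.1, everywhere.** For an axisymmetric divergence-free
`u ∈ C⁴` and every `x ∈ ℝ³`:
`Δ(u^r/r)(x) + 2 radDerivQuot (u^r/r)(x) = ∂₂(ω^θ/r)(x)`, i.e.
`(∂ᵣ² + (3/r)∂ᵣ + ∂_z²)(u^r/r) = ∂_z(ω^θ/r)` — both sides are continuous axisymmetric scalars,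
they agree at the meridian points off the axis (`laplacian_radVelQuot_add_of_meridian`), hence
off the axis by rotation to the meridian half-plane, hence everywhere by density.
[cite: LeiZhang2017, Lemma 2.1] -/
theorem IsAxisymmetric.laplacian_radVelQuot_add (hax : IsAxisymmetric u) (hu : ContDiff ℝ 4 u)
    (hdiv : VectorCalculus.IsDivFree u) (x : EuclideanSpace ℝ (Fin 3)) :
    (Δ (radVelQuot u)) x + 2 * radDerivQuot (radVelQuot u) x =
      fderiv ℝ (angVortQuot u) x (EuclideanSpace.single 2 1) := by
  have hu2 : ContDiff ℝ 2 u := hu.of_le (by norm_num)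
  have hu3 : ContDiff ℝ 3 u := hu.of_le (by norm_num)
  have hρ2 : ContDiff ℝ 2 (radVelQuot u) := contDiff_radVelQuot (n := 2) (by exact_mod_cast hu)
  have hρax : IsAxisymmetricScalar (radVelQuot u) := hax.isAxisymmetricScalar_radVelQuot hu2
  have hω1 : ContDiff ℝ 1 (angVortQuot u) := contDiff_angVortQuot (n := 1) (by exact_mod_cast hu)
  have hωax : IsAxisymmetricScalar (angVortQuot u) := hax.isAxisymmetricScalar_angVortQuot hu3
  -- the two sides as axisymmetric scalars
  set L : EuclideanSpace ℝ (Fin 3) → ℝ := fun y =>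
    (Δ (radVelQuot u)) y + 2 * radDerivQuot (radVelQuot u) y with hL
  set R : EuclideanSpace ℝ (Fin 3) → ℝ := fun y =>
    fderiv ℝ (angVortQuot u) y (EuclideanSpace.single 2 1) with hR
  have hLax : IsAxisymmetricScalar L := fun θ y => by
    simp only [hL]
    rw [hρax.laplacian θ y, isAxisymmetricScalar_radDerivQuot hρ2 hρax θ y]
  have hRax : IsAxisymmetricScalar R :=
    hωax.fderiv_apply_single_two (hω1.differentiable one_ne_zero)
  have hLc : Continuous L :=
    (continuous_laplacian hρ2).add (continuous_const.mul (continuous_radDerivQuot hρ2))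
  have hRc : Continuous R :=
    (contDiff_fderiv_apply_const_succ (n := 0) (by exact_mod_cast hω1) _).continuous
  show L x = R x
  refine eq_of_eq_off_ker (EuclideanSpace.proj (0 : Fin 3)) ⟨EuclideanSpace.single 0 1, by simp⟩
    hLc hRc (fun z hz => ?_) x
  have hz0 : z 0 ≠ 0 := by simpa using hz
  have hr : cylRadius z ≠ 0 := fun h => hz0 ((cylRadius_eq_zero_iff z).1 h).1
  -- rotate to the meridian half-plane
  rw [hLax.eq_comp_meridian z, hRax.eq_comp_meridian z]
  have hm1 : meridianPoint (meridian z) 1 = 0 := rfl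
  have hm0 : meridianPoint (meridian z) 0 ≠ 0 := by
    rw [meridianPoint_apply_zero, meridian_apply]; exact hr
  exact hax.laplacian_radVelQuot_add_of_meridian hu hdiv hm1 hm0

end Identity

end Literature.Analysis.FluidPDE

end
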